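import Summits.QuantumFields.YangMills.Theorems.UnitScaleTiltProp7NestedMeanTowerCloseness
import Summits.QuantumFields.YangMills.Theorems.UnitScaleTiltProp7TowerClosenessGeometric
import Summits.QuantumFields.YangMills.Theorems.UnitScaleTiltProp7TowerClosenessStairs
import HarnessLib

/-!
# Route `UnitScaleTilt`, crux K1 child «MinimiserStabilityRegPr» (stmt-QuantumFields-19200), skeleton v10, stub `stub_existenceMinimalOrbit` (EX), route (α) —
# **R2a′-TOWER (ROW-T), PART 2∕2: THE d = 3 MEMBER.**  At a background `U₀` with print's plaquette clause `|U₀(∂p) − 1| < ε₀L^{−2(K−n)}` ([Balaban1985Variational] (2),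
# `PlaqSmall (regThreshold F n K ε₀) U₀`) and the P0 window `10⁷L³ε₀ ≤ 1`, the rows of ★px20 g2's ROW-B socket `Prop7NestedMeanPoincare.normSq_toL2S_le_two_mul_of_ns_eq_zero`
# are DISCHARGED at the corner-axial references of part 1 (`…NestedMeanTowerCloseness`): with `k = K − n`, `U₀♭ = bgUnits F K U₀`, corner `q Y = fibreSite 0 k Y 0`,
# `C_{j,z,x} = (axialT U₀♭ (q (B^k x)) (embIter j z))⁻¹ · axialT U₀♭ (q (B^k x)) x`, `g_y = (axialT U₀♭ (q y) (embIter k y))⁻¹`: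
# `hC` (all `j`), `hC0`, **`hclose` for `j < K − n` with `η_j = 4500·L²·ε₀·(Lʲη)`**, `hg`, **`htop` with `η' = 0`**, and the budget **`2Σ_{j<K−n} η_j ≤ 4500L²ε₀`**,
# `108ε₀² + 4(2Ση_j)² ≤ 1`.  Inputs: part 1 + [Balaban1985RegularSpaces] Lemma 1 at the corner (`dist1_axial_corner_le`, `s₀ = 6(L^k − 1)·ε₀η²`), the guard-free bridge
# ✓`Prop7SymAvgGLSmallOfRegPr.unitsField_toUField_iter_of_plaqSmall_T3` (the tower is `U1`-valued), `Lᵏη = 1` (✓`pow_mul_eta_eq_one`).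

Cell `ym3-torus`, width seat `ym3-torus-px11` (gen 2); ★w5-20520 g7 «px11: ROW-T GO (FILE 1 then 2)» 19:40:04Z.  THEOREMS ONLY (0 `def`, 0 `sorry`).
`--supports stmt-QuantumFields-19200 --as helper`, count-neutral.  YM₃ on T³ is a ladder rung (R3), not the Clay problem; nothing here claims the stub, the crux, d = 4 or the gap.

WHAT IS PROVED (sorry-free, no definition; ns `…Theorems.Prop7NestedMeanTowerCloseness`): `coe_gaugeActT_axialT_bgUnits` (the `(M₂)ˣ` reading of the gauged field),
★`norm_axialGauge_bond_sub_one_le_T3` (= part 1's `hax` at the carrier), `emlIterU_bgUnits_mem_U1_of_plaqSmall`, `budget_T3`, ★★`hclose_T3`, `ref_T3_mem_U1`, `ref_T3_zero_self`,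
`g_T3_mem_U1`, ★`htop_T3` (`η' = 0`), `two_mul_sum_eta_le_T3`, `window_T3`.
HONEST SCOPE: compositions of landed letters with explicit numerals; the socket (ROW-B) is ★px20 g2's; nothing of print asserted beyond the cited bookkeeping.

References: T. Bałaban, CMP **102** (1985) 277–309 [Balaban1985Variational] ((2) p.278, (146) p.301); CMP **98** (1985) 17–51 [Balaban1985Averaging] ((11) p.19, pp.24–25,
Prop. 4 p.38); CMP **99** (1985) 75–102 [Balaban1985RegularSpaces] (Lemma 1 (1.25) p.79); CMP **99** (1985) 389–434 [Balaban1985BackgroundPropagators] ((3.19) p.393).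
-/

set_option autoImplicit false

noncomputable section

open scoped BigOperators Matrix.Norms.L2Operator

namespace Summit.QuantumFields.YangMills.Theorems.Prop7NestedMeanTowerCloseness

open Literature.MathematicalPhysics.QuantumFieldTheory.Balaban1983to89
open Finset T4Continuum BlockAveraging
open B5Eq118OneStroke (iterBlockOf iterBlock)
open B15DeterminingSets (embIter)
open B7Prop1Explicit (U1 mem_U1 treeWord)
open B10Eq27TorusAxialLog (holT axialT gaugeActT gaugeActT_apply unitsField toUField)
open T3ContinuumYM3Torus
open T3RegularMinimiser (regThreshold regThreshold_pos)
open T3SectALandauChart (eta eta_pos bgUnits)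
open Summit.QuantumFields.YangMills.Theorems.Prop8Chart (emlIterU coe_unitsField_toUField)
open Summit.QuantumFields.YangMills.Theorems.Prop7SymAvgTwSym (holT_mem_U1 unitsField_toUField_mem_U1' pow_mul_eta_eq_one pow_mul_eta_le_one regThreshold_eq_mul_eta_sq)
open Summit.QuantumFields.YangMills.Theorems.Prop7SymAvgGLSmallOfRegPr (unitsField_toUField_iter_of_plaqSmall_T3 bgUnits_eq)
open Summit.QuantumFields.YangMills.Theorems.Prop7SymAvgGL (iterGL_eq_emlIterU)
open Summit.QuantumFields.YangMills.Theorems.Prop7TowerClosenessOfRegPr (holT_unitsField_toUField_eq_map coe_map_eq unitsField_toUField_eq_map)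

section T3

variable (F : T3Family) {n K : ℕ}

/-- The gauged `SU(2)` field read in `(M₂)ˣ` has the same matrices: `↑((U₀♭)^{axialT U₀♭ q}(b)) = ↑((U₀)^{axialT U₀ q}(b))` (the inclusion `SU(2) → (M₂)ˣ` is a group
homomorphism commuting with transports). [cite: Balaban1985Averaging, (8)-(9) pp.18-19, (19) p.21] -/
theorem coe_gaugeActT_axialT_bgUnits (U₀ : GaugeField (F.P K) 0 (Matrix.specialUnitaryGroup (Fin 2) ℂ)) (q : Site (F.P K) 0) (b : PBond (F.P K) 0) :
    ((gaugeActT (axialT (bgUnits F K U₀) q) (bgUnits F K U₀) b : (Matrix (Fin 2) (Fin 2) ℂ)ˣ) : Matrix (Fin 2) (Fin 2) ℂ)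
      = ((gaugeActT (axialT U₀ q) U₀ b : Matrix.specialUnitaryGroup (Fin 2) ℂ) : Matrix (Fin 2) (Fin 2) ℂ) := by
  rw [gaugeActT_apply, gaugeActT_apply, bgUnits_eq]
  unfold axialT
  rw [holT_unitsField_toUField_eq_map, holT_unitsField_toUField_eq_map, ← map_inv,
    show unitsField (toUField U₀) b = (Unitary.toUnits.comp (B10Eq27TorusAxialLog.suIncl (N := 2))) (U₀ b) from rfl, ← map_mul, ← map_mul, coe_map_eq]

/-- ★ **PART 1's ROW `hax` AT THE CARRIER**: on `PlaqSmall (regThreshold F n K ε₀) U₀` every fine bond with both endpoints in one `(K−n)`-block is within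
`2·(3·(L^{K−n} − 1))·ε₀η²` of `1` in the corner-based axial gauge of that block, read in `(M₂)ˣ`. [cite: Balaban1985RegularSpaces, Lemma 1 (1.25) p.79; Balaban1985Variational, (2) p.278] -/
theorem norm_axialGauge_bond_sub_one_le_T3 {ε₀ : ℝ} (hε₀ : 0 < ε₀) (U₀ : GaugeField (F.P K) 0 (Matrix.specialUnitaryGroup (Fin 2) ℂ))
    (hU : PlaqSmall (regThreshold F n K ε₀) U₀) (Y : Site (F.P K) (K - n)) (b : PBond (F.P K) 0)
    (hb : iterBlockOf (K - n) b.src = Y) (hb' : iterBlockOf (K - n) b.tgt = Y) :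
    ‖((gaugeActT (axialT (bgUnits F K U₀) (Site.fibreSite 0 (K - n) Y fun _ => (⟨0, pow_pos (F.P K).L_pos (K - n)⟩ : Fin ((F.P K).L ^ (K - n)))))
        (bgUnits F K U₀) b : (Matrix (Fin 2) (Fin 2) ℂ)ˣ) : Matrix (Fin 2) (Fin 2) ℂ) - 1‖
      ≤ 2 * ((3 : ℝ) * ((F.L : ℝ) ^ (K - n) - 1)) * regThreshold F n K ε₀ := by
  have hk : K - n ≤ (F.P K).m + (F.P K).K := by show K - n ≤ F.m + K; omega
  rw [coe_gaugeActT_axialT_bgUnits, ← SU2Mean.dist1_eq_norm]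
  have h := dist1_axial_corner_le hk U₀ (regThreshold_pos F hε₀) hU (pow_pos (F.P K).L_pos (K - n)) Y b hb hb'
  have hd : ((F.P K).d : ℝ) = 3 := by norm_num [T3Family.P_d]
  have hLL : ((F.P K).L : ℝ) = F.L := rfl
  rw [hd, hLL] at h
  exact h

/-- **THE BACKGROUND TOWER IS `U1`-VALUED ON THE PLAQUETTE WINDOW** (`j ≤ K − n`, `10⁷L³ε₀ ≤ 1`): the unguarded average IS the route's `SU(2)` average there
(✓`unitsField_toUField_iter_of_plaqSmall_T3`). [cite: Balaban1987RG1, (0.11) p.253; Balaban1985Variational, (146) p.301] -/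
theorem emlIterU_bgUnits_mem_U1_of_plaqSmall {ε₀ : ℝ} (hε₀ : 0 < ε₀) (hε7 : 10 ^ 7 * (F.L : ℝ) ^ 3 * ε₀ ≤ 1)
    (U₀ : GaugeField (F.P K) 0 (Matrix.specialUnitaryGroup (Fin 2) ℂ)) (hU : PlaqSmall (regThreshold F n K ε₀) U₀) {j : ℕ} (hj : j ≤ K - n)
    (b : PBond (F.P K) j) : emlIterU j (bgUnits F K U₀) b ∈ U1 (Matrix (Fin 2) (Fin 2) ℂ) := by
  rw [bgUnits_eq, ← iterGL_eq_emlIterU, ← unitsField_toUField_iter_of_plaqSmall_T3 F n K hε₀ hε7 U₀ hU hj]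
  exact unitsField_toUField_mem_U1' _ b

/-- numerics: `ℓ = 5L`, `Lᵏη = 1`, `Lʲη ≤ 1` ⟹ the Prop-4 budget `6400ℓ²Lʲ·s₀ ≤ 1` and the row constant `ℓ·30ℓLʲs₀ ≤ 4500L²ε₀·(Lʲη)` for `s₀ = 6(Lᵏ−1)ε₀η²`, `j ≤ K − n`,
under `10⁷L³ε₀ ≤ 1`. [cite: Balaban1985Averaging, Prop. 4 (134) p.38; Balaban1985Variational, (146) p.301] -/
theorem budget_T3 {ε₀ : ℝ} (hε₀ : 0 < ε₀) (hε7 : 10 ^ 7 * (F.L : ℝ) ^ 3 * ε₀ ≤ 1) {j : ℕ} (hj : j ≤ K - n) :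
    6400 * ((((F.P K).d + 2) * (F.P K).L : ℕ) : ℝ) ^ 2 * ((F.P K).L : ℝ) ^ j * (2 * ((3 : ℝ) * ((F.L : ℝ) ^ (K - n) - 1)) * regThreshold F n K ε₀) ≤ 1 ∧
    ((((F.P K).d + 2) * (F.P K).L : ℕ) : ℝ) * (30 * ((((F.P K).d + 2) * (F.P K).L : ℕ) : ℝ) * ((F.P K).L : ℝ) ^ j * (2 * ((3 : ℝ) * ((F.L : ℝ) ^ (K - n) - 1)) * regThreshold F n K ε₀))
      ≤ 4500 * (F.L : ℝ) ^ 2 * ε₀ * ((F.L : ℝ) ^ j * eta F n K) := by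
  have hd : (F.P K).d = 3 := T3Family.P_d F K
  have hLL : ((F.P K).L : ℝ) = F.L := rfl
  have hL3 : 3 ≤ F.L := by obtain ⟨a, ha⟩ := F.hL.1; have := F.hL.2; omega
  have hL3r : (3 : ℝ) ≤ F.L := by exact_mod_cast hL3
  have hℓ : ((((F.P K).d + 2) * (F.P K).L : ℕ) : ℝ) = 5 * (F.L : ℝ) := by rw [hd, ← hLL]; push_cast; ring
  have hη : 0 < eta F n K := eta_pos F n K
  have hx1 : (F.L : ℝ) ^ j * eta F n K ≤ 1 := pow_mul_eta_le_one F hj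
  have hx0 : 0 ≤ (F.L : ℝ) ^ j * eta F n K := by positivity
  have hk1 : (F.L : ℝ) ^ (K - n) * eta F n K = 1 := pow_mul_eta_eq_one F
  have hreg : regThreshold F n K ε₀ = ε₀ * eta F n K ^ 2 := regThreshold_eq_mul_eta_sq F ε₀
  -- the common product `L^j·(L^k − 1)·η² ≤ (L^jη)(L^kη) = L^jη ≤ 1`
  have hprod : ((F.L : ℝ) ^ j) * (((F.L : ℝ) ^ (K - n) - 1) * eta F n K ^ 2) ≤ (F.L : ℝ) ^ j * eta F n K := by
    have h1 : ((F.L : ℝ) ^ (K - n) - 1) * eta F n K ^ 2 ≤ eta F n K := by nlinarith [hη, hk1]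
    exact mul_le_mul_of_nonneg_left h1 (by positivity)
  have hLε : (F.L : ℝ) ^ 2 * ε₀ * 10 ^ 7 * F.L ≤ 1 := by nlinarith [hε7]
  have hL2ε : 0 ≤ (F.L : ℝ) ^ 2 * ε₀ := by positivity
  rw [hℓ, hLL, hreg]
  constructor
  · have e : 6400 * (5 * (F.L : ℝ)) ^ 2 * (F.L : ℝ) ^ j * (2 * (3 * ((F.L : ℝ) ^ (K - n) - 1)) * (ε₀ * eta F n K ^ 2))
        = 960000 * ((F.L : ℝ) ^ 2 * ε₀) * (((F.L : ℝ) ^ j) * (((F.L : ℝ) ^ (K - n) - 1) * eta F n K ^ 2)) := by ring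
    rw [e]
    calc 960000 * ((F.L : ℝ) ^ 2 * ε₀) * (((F.L : ℝ) ^ j) * (((F.L : ℝ) ^ (K - n) - 1) * eta F n K ^ 2))
        ≤ 960000 * ((F.L : ℝ) ^ 2 * ε₀) * 1 := by
          refine mul_le_mul_of_nonneg_left (hprod.trans hx1) (by positivity)
      _ ≤ 1 := by nlinarith
  · have e : 5 * (F.L : ℝ) * (30 * (5 * (F.L : ℝ)) * (F.L : ℝ) ^ j * (2 * (3 * ((F.L : ℝ) ^ (K - n) - 1)) * (ε₀ * eta F n K ^ 2)))
        = 4500 * (F.L : ℝ) ^ 2 * ε₀ * (((F.L : ℝ) ^ j) * (((F.L : ℝ) ^ (K - n) - 1) * eta F n K ^ 2)) := by ring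
    rw [e]
    exact mul_le_mul_of_nonneg_left hprod (by positivity)

/-- ★★ **ROW `hclose` AT THE CARRIER, `j < K − n`, `η_j = 4500L²ε₀·(Lʲη)`** — ★px20 g2's `hclose` binder letter for letter at the corner-axial references.
[cite: Balaban1985Averaging, Prop. 4 (134)-(135) p.38, (11) p.19; Balaban1985RegularSpaces, Lemma 1 p.79; Balaban1985Variational, (2) p.278] -/
theorem hclose_T3 {ε₀ : ℝ} (hε₀ : 0 < ε₀) (hε7 : 10 ^ 7 * (F.L : ℝ) ^ 3 * ε₀ ≤ 1)
    (U₀ : GaugeField (F.P K) 0 (Matrix.specialUnitaryGroup (Fin 2) ℂ)) (hU : PlaqSmall (regThreshold F n K ε₀) U₀) :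
    ∀ j, j < K - n → ∀ (y : Site (F.P K) (j + 1)) (i : Idx (F.P K)), ∀ x ∈ iterBlock j (Site.blockSite y i.1),
      ‖((holT (emlIterU j (bgUnits F K U₀)) (emb y) (stairWord i.2.1 (off i.1)) : (Matrix (Fin 2) (Fin 2) ℂ)ˣ) : Matrix (Fin 2) (Fin 2) ℂ) *
          (((axialT (bgUnits F K U₀) (Site.fibreSite 0 (K - n) (iterBlockOf (K - n) x) fun _ => (⟨0, pow_pos (F.P K).L_pos (K - n)⟩ : Fin ((F.P K).L ^ (K - n))))
                (embIter j (Site.blockSite y i.1)))⁻¹ *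
              axialT (bgUnits F K U₀) (Site.fibreSite 0 (K - n) (iterBlockOf (K - n) x) fun _ => (⟨0, pow_pos (F.P K).L_pos (K - n)⟩ : Fin ((F.P K).L ^ (K - n)))) x :
              (Matrix (Fin 2) (Fin 2) ℂ)ˣ) : Matrix (Fin 2) (Fin 2) ℂ)
        - (((axialT (bgUnits F K U₀) (Site.fibreSite 0 (K - n) (iterBlockOf (K - n) x) fun _ => (⟨0, pow_pos (F.P K).L_pos (K - n)⟩ : Fin ((F.P K).L ^ (K - n))))
                (embIter (j + 1) y))⁻¹ *
              axialT (bgUnits F K U₀) (Site.fibreSite 0 (K - n) (iterBlockOf (K - n) x) fun _ => (⟨0, pow_pos (F.P K).L_pos (K - n)⟩ : Fin ((F.P K).L ^ (K - n)))) x :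
              (Matrix (Fin 2) (Fin 2) ℂ)ˣ) : Matrix (Fin 2) (Fin 2) ℂ)‖
        ≤ 4500 * (F.L : ℝ) ^ 2 * ε₀ * ((F.L : ℝ) ^ j * eta F n K) := by
  intro j hj y i x hx
  have hk : K - n ≤ (F.P K).m + (F.P K).K := by show K - n ≤ F.m + K; omega
  have hjk : j + 1 ≤ K - n := hj
  have hL1 : (1 : ℝ) ≤ (F.L : ℝ) ^ (K - n) := one_le_pow₀ (by have := F.hL.2; exact_mod_cast (show 1 ≤ F.L by omega))
  have hs₀ : 0 ≤ 2 * ((3 : ℝ) * ((F.L : ℝ) ^ (K - n) - 1)) * regThreshold F n K ε₀ := by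
    have := (regThreshold_pos F (n := n) (K := K) hε₀).le
    have : (0 : ℝ) ≤ (F.L : ℝ) ^ (K - n) - 1 := by linarith
    positivity
  obtain ⟨hbud, hrow⟩ := budget_T3 F hε₀ hε7 (Nat.le_of_succ_le hjk)
  refine le_trans ?_ hrow
  exact norm_stair_mul_ref_sub_ref_le hjk hk (bgUnits F K U₀) (fun b => unitsField_toUField_mem_U1' U₀ b)
    (fun b => emlIterU_bgUnits_mem_U1_of_plaqSmall F hε₀ hε7 U₀ hU (Nat.le_of_succ_le hjk) b)
    (fun Y => Site.fibreSite 0 (K - n) Y fun _ => (⟨0, pow_pos (F.P K).L_pos (K - n)⟩ : Fin ((F.P K).L ^ (K - n)))) hs₀ hbud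
    (fun Y b hb hb' => norm_axialGauge_bond_sub_one_le_T3 F hε₀ U₀ hU Y b hb hb') y i x hx

/-- `hC`: the carrier's references are `U1`-valued (every `j`). [cite: Balaban1985Averaging, (19)-(20) p.21] -/
theorem ref_T3_mem_U1 (U₀ : GaugeField (F.P K) 0 (Matrix.specialUnitaryGroup (Fin 2) ℂ)) (j : ℕ) (z : Site (F.P K) j) (x : Site (F.P K) 0) :
    (axialT (bgUnits F K U₀) (Site.fibreSite 0 (K - n) (iterBlockOf (K - n) x) fun _ => (⟨0, pow_pos (F.P K).L_pos (K - n)⟩ : Fin ((F.P K).L ^ (K - n))))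
          (embIter j z))⁻¹ *
        axialT (bgUnits F K U₀) (Site.fibreSite 0 (K - n) (iterBlockOf (K - n) x) fun _ => (⟨0, pow_pos (F.P K).L_pos (K - n)⟩ : Fin ((F.P K).L ^ (K - n)))) x
      ∈ U1 (Matrix (Fin 2) (Fin 2) ℂ) :=
  ref_mem_U1 (bgUnits F K U₀) (fun b => unitsField_toUField_mem_U1' U₀ b)
    (fun Y => Site.fibreSite 0 (K - n) Y fun _ => (⟨0, pow_pos (F.P K).L_pos (K - n)⟩ : Fin ((F.P K).L ^ (K - n)))) j z x

/-- `hC0` at the carrier. [cite: Balaban1984PropagatorsI, (1.18) p.20] -/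
theorem ref_T3_zero_self (U₀ : GaugeField (F.P K) 0 (Matrix.specialUnitaryGroup (Fin 2) ℂ)) (x : Site (F.P K) 0) :
    (axialT (bgUnits F K U₀) (Site.fibreSite 0 (K - n) (iterBlockOf (K - n) x) fun _ => (⟨0, pow_pos (F.P K).L_pos (K - n)⟩ : Fin ((F.P K).L ^ (K - n))))
          (embIter 0 x))⁻¹ *
        axialT (bgUnits F K U₀) (Site.fibreSite 0 (K - n) (iterBlockOf (K - n) x) fun _ => (⟨0, pow_pos (F.P K).L_pos (K - n)⟩ : Fin ((F.P K).L ^ (K - n)))) x = 1 :=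
  ref_zero_self (bgUnits F K U₀) (fun Y => Site.fibreSite 0 (K - n) Y fun _ => (⟨0, pow_pos (F.P K).L_pos (K - n)⟩ : Fin ((F.P K).L ^ (K - n)))) x

/-- `hg`: the top-level frames `g_y = (axialT U₀♭ (corner y) (embIter k y))⁻¹` are `U1`-valued. [cite: Balaban1985Averaging, (19)-(20) p.21] -/
theorem g_T3_mem_U1 (U₀ : GaugeField (F.P K) 0 (Matrix.specialUnitaryGroup (Fin 2) ℂ)) (y : Site (F.P K) (K - n)) :
    (axialT (bgUnits F K U₀) (Site.fibreSite 0 (K - n) y fun _ => (⟨0, pow_pos (F.P K).L_pos (K - n)⟩ : Fin ((F.P K).L ^ (K - n)))) (embIter (K - n) y))⁻¹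
      ∈ U1 (Matrix (Fin 2) (Fin 2) ℂ) := by
  unfold axialT
  exact (U1 _).inv_mem (holT_mem_U1 (fun b => unitsField_toUField_mem_U1' U₀ b) _ _)

/-- ★ **ROW `htop` AT THE CARRIER WITH `η' = 0`**: the top reference at `x_r = fibreSite 0 (K−n) y r` IS `g_y · U₀♭(Γ_{corner(y), r})` (part 1 `ref_top_fibreSite_eq`), so
★px20 g2's `htop` holds with `η' = 0`. [cite: Balaban1984PropagatorsI, (1.18) p.20; Balaban1985Averaging, pp.24-25] -/
theorem htop_T3 (U₀ : GaugeField (F.P K) 0 (Matrix.specialUnitaryGroup (Fin 2) ℂ)) :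
    ∀ (y : Site (F.P K) (K - n)) (r : Fin (F.P K).d → Fin ((F.P K).L ^ (K - n))),
      ‖(((axialT (bgUnits F K U₀) (Site.fibreSite 0 (K - n) (iterBlockOf (K - n) (Site.fibreSite 0 (K - n) y r))
                  fun _ => (⟨0, pow_pos (F.P K).L_pos (K - n)⟩ : Fin ((F.P K).L ^ (K - n)))) (embIter (K - n) y))⁻¹ *
            axialT (bgUnits F K U₀) (Site.fibreSite 0 (K - n) (iterBlockOf (K - n) (Site.fibreSite 0 (K - n) y r))
                fun _ => (⟨0, pow_pos (F.P K).L_pos (K - n)⟩ : Fin ((F.P K).L ^ (K - n)))) (Site.fibreSite 0 (K - n) y r) :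
            (Matrix (Fin 2) (Fin 2) ℂ)ˣ) : Matrix (Fin 2) (Fin 2) ℂ)
        - (((axialT (bgUnits F K U₀) (Site.fibreSite 0 (K - n) y fun _ => (⟨0, pow_pos (F.P K).L_pos (K - n)⟩ : Fin ((F.P K).L ^ (K - n))))
                (embIter (K - n) y))⁻¹ : (Matrix (Fin 2) (Fin 2) ℂ)ˣ) : Matrix (Fin 2) (Fin 2) ℂ) *
            ((holT (unitsField (toUField U₀)) (Site.fibreSite 0 (K - n) y fun _ => (⟨0, pow_pos (F.P K).L_pos (K - n)⟩ : Fin ((F.P K).L ^ (K - n))))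
                (treeWord fun ν => ((r ν : ℕ) : ℤ)) : (Matrix (Fin 2) (Fin 2) ℂ)ˣ) : Matrix (Fin 2) (Fin 2) ℂ)‖ ≤ 0 := by
  intro y r
  have hk : K - n ≤ (F.P K).m + (F.P K).K := by show K - n ≤ F.m + K; omega
  rw [ref_top_fibreSite_eq hk (bgUnits F K U₀) (pow_pos (F.P K).L_pos (K - n)) y r, Units.val_mul, bgUnits_eq, sub_self, norm_zero]

/-- **THE TOWER SUM IS L-ONLY**: `2·Σ_{j<K−n} η_j ≤ 4500L²ε₀` (`η_j = 4500L²ε₀·Lʲη`, `η·Σ_{j<k}Lʲ = (Lᵏη − η)∕(L − 1) ≤ 1∕(L−1) ≤ ½`).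
[cite: Balaban1985BackgroundPropagators, (3.19) p.393; Balaban1985Variational, (2) p.278] -/
theorem two_mul_sum_eta_le_T3 {ε₀ : ℝ} (hε₀ : 0 ≤ ε₀) :
    2 * ∑ j ∈ range (K - n), 4500 * (F.L : ℝ) ^ 2 * ε₀ * ((F.L : ℝ) ^ j * eta F n K) ≤ 4500 * (F.L : ℝ) ^ 2 * ε₀ := by
  have hL3 : 3 ≤ F.L := by obtain ⟨a, ha⟩ := F.hL.1; have := F.hL.2; omega
  have hL3r : (3 : ℝ) ≤ F.L := by exact_mod_cast hL3
  have hη : 0 < eta F n K := eta_pos F n K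
  have hk1 : (F.L : ℝ) ^ (K - n) * eta F n K = 1 := pow_mul_eta_eq_one F
  have hgeom : (∑ j ∈ range (K - n), (F.L : ℝ) ^ j) * ((F.L : ℝ) - 1) = (F.L : ℝ) ^ (K - n) - 1 := geom_sum_mul _ _
  have hsum : 2 * ((∑ j ∈ range (K - n), (F.L : ℝ) ^ j) * eta F n K) ≤ 1 := by
    -- `(L − 1)·(η·ΣLʲ) = Lᵏη − η ≤ 1` and `L − 1 ≥ 2`
    have h1 : ((∑ j ∈ range (K - n), (F.L : ℝ) ^ j) * eta F n K) * ((F.L : ℝ) - 1) = 1 - eta F n K := by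
      calc ((∑ j ∈ range (K - n), (F.L : ℝ) ^ j) * eta F n K) * ((F.L : ℝ) - 1)
          = ((∑ j ∈ range (K - n), (F.L : ℝ) ^ j) * ((F.L : ℝ) - 1)) * eta F n K := by ring
        _ = 1 - eta F n K := by rw [hgeom, sub_mul, hk1, one_mul]
    have h0 : 0 ≤ (∑ j ∈ range (K - n), (F.L : ℝ) ^ j) * eta F n K :=
      mul_nonneg (sum_nonneg fun j _ => by positivity) hη.le
    nlinarith
  have e : 2 * ∑ j ∈ range (K - n), 4500 * (F.L : ℝ) ^ 2 * ε₀ * ((F.L : ℝ) ^ j * eta F n K)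
      = 4500 * (F.L : ℝ) ^ 2 * ε₀ * (2 * ((∑ j ∈ range (K - n), (F.L : ℝ) ^ j) * eta F n K)) := by
    rw [sum_mul, mul_sum, mul_sum, mul_sum]
    refine sum_congr rfl fun j _ => ?_
    ring
  rw [e]
  calc 4500 * (F.L : ℝ) ^ 2 * ε₀ * (2 * ((∑ j ∈ range (K - n), (F.L : ℝ) ^ j) * eta F n K)) ≤ 4500 * (F.L : ℝ) ^ 2 * ε₀ * 1 :=
        mul_le_mul_of_nonneg_left hsum (by positivity)
    _ = 4500 * (F.L : ℝ) ^ 2 * ε₀ := mul_one _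

/-- **THE SOCKET'S WINDOW** `108ε₀² + 4·(2Σ_{j<K−n}η_j + 2·0)² ≤ 1` under `10⁷L³ε₀ ≤ 1`. [cite: Balaban1985Variational, (146) p.301] -/
theorem window_T3 {ε₀ : ℝ} (hε₀ : 0 < ε₀) (hε7 : 10 ^ 7 * (F.L : ℝ) ^ 3 * ε₀ ≤ 1) :
    108 * ε₀ ^ 2 + 4 * (2 * ∑ j ∈ range (K - n), 4500 * (F.L : ℝ) ^ 2 * ε₀ * ((F.L : ℝ) ^ j * eta F n K) + 2 * 0) ^ 2 ≤ 1 := by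
  have hL3 : 3 ≤ F.L := by obtain ⟨a, ha⟩ := F.hL.1; have := F.hL.2; omega
  have hL3r : (3 : ℝ) ≤ F.L := by exact_mod_cast hL3
  have hS := two_mul_sum_eta_le_T3 F (n := n) (K := K) hε₀.le
  have hS0 : 0 ≤ 2 * ∑ j ∈ range (K - n), 4500 * (F.L : ℝ) ^ 2 * ε₀ * ((F.L : ℝ) ^ j * eta F n K) :=
    mul_nonneg (by norm_num) (sum_nonneg fun j _ => by have := (eta_pos F n K).le; positivity)
  -- `4500L²ε₀ ≤ 4500∕(10⁷L) ≤ 1.5·10⁻⁴`, `ε₀ ≤ 10⁻⁷∕27`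
  have hA : 4500 * (F.L : ℝ) ^ 2 * ε₀ ≤ 1 / 4 := by nlinarith [hε7]
  have hB : ε₀ ≤ 1 / 27 := by nlinarith [hε7]
  rw [mul_zero, add_zero]
  nlinarith [hS, hS0, hA, hB, sq_nonneg ε₀]

end T3

end Summit.QuantumFields.YangMills.Theorems.Prop7NestedMeanTowerCloseness

end
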